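import Summits.BirchSwinnertonDyer.Rank1Residual.Additive.GordSpecialFibreExplicit
import Summits.BirchSwinnertonDyer.Rank1Residual.Additive.ReductionPointCountBaseChange
import Summits.BirchSwinnertonDyer.Rank1Residual.Additive.SpecialJTraceCongruence1728
import Summits.BirchSwinnertonDyer.Rank1Residual.Additive.SpecialJAnomalousFive
import Mathlib.Data.ZMod.Basic
import HarnessLib

/-!
# The ANOMALOUS BIT on defect `4` is ONE RESIDUE of Cremona's `c₄` (gen 35's LAW 6 as a theorem):
# `ReductionNonAnomalous W p` DECIDED on the whole defect-`4` (G)-cell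

HONEST FRAMING (cell `b2b-bsdres`, run/shared/lean/b2b/bsd-rank1-residual/, verbatim in every
file): the goal of the cell is to DELETE the COMBINATION-SHAPED residual classes of the
Birch–Swinnerton-Dyer formula for ALL analytic-rank `≤ 1` elliptic curves over `ℚ` — "full BSD
formula for every rank `≤ 1` curve in class `C`" assembled STRICTLY from published theorems — so
that the rank-`≤ 1` remainder becomes exactly the CONSTRUCTION-SHAPED classes, which are TYPED
(missing-input `Prop`s), NOT attempted. This is not "finishing BSD". Sub-cell `additive-p2`
(X3♯(G-ord) / X4♯(G-ord)), generation 36, part 4: research route; no claim beyond the stated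
classes; theorems only, no definition, no named fact, nothing booked, no label moved.

## What is proved

`W` a globally minimal model of `E/ℚ` with `e_E(p) = 4` (Kodaira `III`, `III*`), `p ≥ 5`,
`4 ∣ p − 1`, and `c₄(E) = n·(−p)^v` with `p ∤ n` (Cremona: `v = v_p(c₄)`, `n = c₄/(−p)^v`; part 3).

* `exists_heightOneSpectrum_cyclotomic_over` — **every (G)-field place lifts to `ℚ(ζ_p)` with the
  same point count**: for `F ⊆ L = ℚ(ζ_p)` and a place `w ∋ p` of `F` at which `E_F` is good there is a
  place `𝔓 ∋ p` of `L` with `E_L` good at `𝔓` and `#Ẽ_𝔓(k_𝔓) = #Ẽ_w(k_w)` (part 6 + good reduction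
  ascends + all residue degrees are `1`);
* **`intCast_trace_reductionAt_eq_and_dvd_iff_of_semistabilityIndex_eq_four`** (`K` a `p`-th
  cyclotomic field, `𝔭 ∋ p` good for `E_K`): in `k_𝔭 = 𝔽_p`,
  **`p + 1 − #Ẽ_𝔭 = C((p−1)/2,(p−1)/4)·(−n/48)^{(p−1)/4}`**, and
  **`p ∣ #Ẽ_𝔭(𝔽_p) ⟺ C((p−1)/2,(p−1)/4)·(−n/48)^{(p−1)/4} = 1` in `ZMod p`** (census LAW 6: 265/265);
* **`reductionNonAnomalous_iff_of_semistabilityIndex_eq_four`** — on the type-(G) locus with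
  `e_E(p) = 4`: **`Delbourgo2002.ReductionNonAnomalous W p ⟺ ¬(C((p−1)/2,(p−1)/4)·(−n/48)^{(p−1)/4} = 1
  in ZMod p)`** — Delbourgo's `ℓ_p(E)` proviso on the defect-`4` cell is ONE decidable residue of
  Cremona's `c₄`;
* `p = 5`: **`five_dvd_natCard_point_reductionAt_iff_intCast_modEq_one`** (`5 ∣ #Ẽ_𝔭(𝔽_5) ⟺ n ≡ 1
  (mod 5)`) and **`reductionNonAnomalous_five_iff_of_semistabilityIndex_eq_four`**
  (`ReductionNonAnomalous W 5 ⟺ ¬ n ≡ 1 (mod 5)`; census: the 70 anomalous defect-`4` rows are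
  exactly the rows with `c₄/(−5)^{v_5(c₄)} ≡ 1 (mod 5)`, 233/233; `#Ẽ(𝔽_5) = 10, 4, 8, 2` for
  `n ≡ 1, 2, 3, 4`).

References: D. Delbourgo, J. Number Theory 95 (2002) p. 39 (`ℓ_p(E)`); B. Mazur, Invent. Math. 18
(1972) §5; K. Ireland, M. Rosen, GTM 84, Ch. 18 §4 Thm. 5; J. H. Silverman, *AEC* VII.1.3(b),
V.4.1(a); L. C. Washington, GTM 83, Lemma 1.4.
-/

noncomputable section

open scoped Classical NumberField

open WeierstrassCurve IsDedekindDomain IsDedekindDomain.HeightOneSpectrum NumberField IsLocalRing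
  Literature.NumberTheory.EllipticCurves Literature.NumberTheory.EllipticCurves.Rank1Residual

namespace Summit.BirchSwinnertonDyer.Rank1Residual.Additive

/-! ### Bookkeeping: prime fields, and the lift of a (G)-field place to `ℚ(ζ_p)` -/

section Aux

variable (p : ℕ) [hp : Fact p.Prime]

/-- In a field `k` with a prime number `p` of elements, `t ≠ 0` has `(t^e)^{(p−1)/e} = t^{p−1} = 1`
for `e ∣ p − 1`. [folklore] -/
theorem pow_pow_div_eq_one_of_natCard_eq {k : Type*} [Field k] [Finite k] (hcard : Nat.card k = p)
    {e : ℕ} (he : e ∣ p - 1) {t : k} (ht : t ≠ 0) : (t ^ e) ^ ((p - 1) / e) = 1 := by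
  haveI := Fintype.ofFinite k
  obtain ⟨-, hq⟩ := SpecialJ.ringChar_eq_of_natCard_eq (k := k) hp.out hcard
  rw [← pow_mul, Nat.mul_div_cancel' he, ← hq]
  exact FiniteField.pow_card_sub_one_eq_one t ht

omit hp in
/-- In characteristic `p`: **`p ∣ N ⟺ p + 1 − N ≡ 1`**. [folklore] -/
theorem dvd_iff_of_intCast_trace_eq {k : Type*} [Ring k] [CharP k p] {N : ℕ} {x : k}
    (h : ((((p : ℤ) + 1 - N) : ℤ) : k) = x) : p ∣ N ↔ x = 1 := by
  rw [← h]
  push_cast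
  rw [CharP.cast_eq_zero k p, zero_add, sub_eq_self, CharP.cast_eq_zero_iff k p]

/-- Transport of the residue condition `a·(−n/d)^m = 1` from any field of characteristic `p` to
`ZMod p` (so that it is ONE decidable residue of the integer `n`). [folklore] -/
theorem natCast_mul_pow_eq_one_iff_zmod {k : Type*} [Field k] [CharP k p] (a d m : ℕ) (n : ℤ) :
    (a : k) * (-(n : k) / d) ^ m = 1 ↔ (a : ZMod p) * (-(n : ZMod p) / d) ^ m = 1 := by
  set f : ZMod p →+* k := ZMod.castHom (dvd_refl p) k with hf
  have hfx : f ((a : ZMod p) * (-(n : ZMod p) / d) ^ m) = (a : k) * (-(n : k) / d) ^ m := by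
    rw [map_mul, map_pow, map_div₀, map_neg, map_natCast, map_intCast, map_natCast]
  rw [← hfx, ← map_one f]
  exact ⟨fun h ↦ f.injective h, fun h ↦ congrArg f h⟩

/-- **Every (G)-field place lifts to `ℚ(ζ_p)` with the same point count.** For an intermediate field
`F` of a `p`-th cyclotomic field `L` and a place `w ∋ p` of `F` at which `E_F` has good reduction,
there is a place `𝔓 ∋ p` of `L` at which `E_L` has good reduction and **`#Ẽ_𝔓(k_𝔓) = #Ẽ_w(k_w)`**
(good reduction ascends, `hasGoodReductionAt_baseChange_of_hasGoodReductionAt`; both residue fields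
are `𝔽_p`, `absNorm_eq_of_intermediateField_cyclotomic`; part 6). So Delbourgo's non-anomalous
condition over the (G)-fields is read at `ℚ(ζ_p)` alone. [folklore] -/
theorem exists_heightOneSpectrum_cyclotomic_over (W : WeierstrassCurve ℚ) [W.IsElliptic]
    {L : Type} [Field L] [NumberField L] [IsCyclotomicExtension {p} ℚ L]
    (F : IntermediateField ℚ L) (w : HeightOneSpectrum (𝓞 F)) (hw : (p : 𝓞 F) ∈ w.asIdeal)
    (hgood : (W.baseChange F).HasGoodReductionAt w) :
    ∃ 𝔓 : HeightOneSpectrum (𝓞 L), (p : 𝓞 L) ∈ 𝔓.asIdeal ∧ (W.baseChange L).HasGoodReductionAt 𝔓 ∧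
      Nat.card ((W.baseChange L).reductionAt 𝔓).toAffine.Point =
        Nat.card ((W.baseChange F).reductionAt w).toAffine.Point := by
  haveI : NumberField F := NumberField.of_module_finite ℚ F
  haveI : (W.baseChange F).IsElliptic := by rw [baseChange]; infer_instance
  haveI := w.isMaximal
  obtain ⟨Q, hQmax, hQover⟩ :=
    Ideal.exists_maximal_ideal_liesOver_of_isIntegral (S := 𝓞 L) w.asIdeal
  have hpQ : (p : 𝓞 L) ∈ Q := by
    have h : (p : 𝓞 F) ∈ Q.under (𝓞 F) := hQover.over ▸ hw
    rw [Ideal.under_def, Ideal.mem_comap, map_natCast] at h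
    exact h
  have hQne : Q ≠ ⊥ := by
    rintro rfl
    exact (Nat.cast_ne_zero.mpr hp.out.ne_zero : (p : 𝓞 L) ≠ 0) ((Submodule.mem_bot (𝓞 L)).mp hpQ)
  let 𝔓 : HeightOneSpectrum (𝓞 L) := ⟨Q, hQmax.isPrime, hQne⟩
  haveI hover : 𝔓.asIdeal.LiesOver w.asIdeal := hQover
  -- good reduction ascends, along the identification `(E_F)_L = E_L`
  have hFL : (W.baseChange F).baseChange L = W.baseChange L :=
    W.map_baseChange (IsScalarTower.toAlgHom ℚ F L)
  have hgoodL := hasGoodReductionAt_baseChange_of_hasGoodReductionAt (W.baseChange F) L w 𝔓 hgood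
  -- both residue fields have `p` elements
  obtain ⟨𝔭₀, -, huniq, hN⟩ := exists_prime_over_prime p L
  have h𝔓₀ : 𝔓 = 𝔭₀ := by
    have : 𝔓 ∈ ({𝔭₀} : Set (HeightOneSpectrum (𝓞 L))) := by rw [← huniq]; exact_mod_cast hpQ
    exact this
  haveI : w.asIdeal.LiesOver (Ideal.span {(p : ℤ)}) := Ideal.liesOver_span_of_natCast_mem' hp.out hw
  have hk : Nat.card (ResidueField (w.adicCompletionIntegers F)) =
      Nat.card (ResidueField (𝔓.adicCompletionIntegers L)) := by
    rw [natCard_residueField_adicCompletionIntegers_eq_of_absNorm w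
        (absNorm_eq_of_intermediateField_cyclotomic p F w),
      natCard_residueField_adicCompletionIntegers_eq_of_absNorm 𝔓 (h𝔓₀ ▸ hN)]
  have hcount := natCard_point_reductionAt_baseChange_eq_of_natCard_residueField_eq L w 𝔓
    (W.baseChange F) hgood hk
  rw [hFL] at hgoodL hcount
  exact ⟨𝔓, hpQ, hgoodL, hcount⟩

end Aux

/-! ### Defect `4`: the trace and the anomalous bit from `n = c₄/(−p)^v` -/

section Four

variable (W : WeierstrassCurve ℚ) [W.IsElliptic] [W.IsGloballyMinimal] (p : ℕ) [hp : Fact p.Prime]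

/-- **LAW 6 (defect `4`): the trace and the anomalous bit are one quartic residue of `c₄/(−p)^v`.**
Let `W` be globally minimal, `p ≥ 5`, `4 ∣ p − 1`, `e_E(p) = 4`, `K` a `p`-th cyclotomic field, `𝔭 ∋ p`
good for `E_K`, and `c₄(E) = n·(−p)^v` with `p ∤ n`. Then in `k_𝔭 = 𝔽_p`:
**`p + 1 − #Ẽ_𝔭 = C((p−1)/2,(p−1)/4)·(−n/48)^{(p−1)/4}`**, and
**`p ∣ #Ẽ_𝔭(𝔽_p) ⟺ C((p−1)/2,(p−1)/4)·(−n/48)^{(p−1)/4} = 1` in `ZMod p`** (census: traces at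
`p ∈ {13, 17, 29, 37, 53}` 32/32, at `5` 233/233). [cite: IrelandRosen1990, Ch. 18 §4, Theorem 5] -/
theorem intCast_trace_reductionAt_eq_and_dvd_iff_of_semistabilityIndex_eq_four (hp5 : 5 ≤ p)
    (h4 : 4 ∣ p - 1) (he : semistabilityIndex W p = 4)
    {K : Type} [Field K] [NumberField K] [IsCyclotomicExtension {p} ℚ K]
    {𝔭 : HeightOneSpectrum (𝓞 K)} (h𝔭 : (p : 𝓞 K) ∈ 𝔭.asIdeal)
    (hgood : (W.baseChange K).HasGoodReductionAt 𝔭) {n : ℤ} {v : ℕ} (hpn : ¬ (p : ℤ) ∣ n)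
    (hn : W.c₄ = n * (-(p : ℚ)) ^ v) :
    (((p : ℤ) + 1 - Nat.card ((W.baseChange K).reductionAt 𝔭).toAffine.Point : ℤ) :
        ResidueField (𝔭.adicCompletionIntegers K)) =
      ((((p - 1) / 2).choose ((p - 1) / 4) : ℕ) : ResidueField (𝔭.adicCompletionIntegers K)) *
        (-(n : ResidueField (𝔭.adicCompletionIntegers K)) / 48) ^ ((p - 1) / 4) ∧
    (p ∣ Nat.card ((W.baseChange K).reductionAt 𝔭).toAffine.Point ↔
      ((((p - 1) / 2).choose ((p - 1) / 4) : ℕ) : ZMod p) * (-(n : ZMod p) / 48) ^ ((p - 1) / 4) = 1) := by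
  haveI : (W.baseChange K).IsElliptic := by rw [baseChange]; infer_instance
  haveI : ((W.baseChange K).reductionAt 𝔭).IsElliptic := isElliptic_reductionAt hgood
  obtain ⟨𝔭₀, -, huniq, hN⟩ := exists_prime_over_prime p K
  have h𝔭₀ : 𝔭 = 𝔭₀ := by
    have : 𝔭 ∈ ({𝔭₀} : Set (HeightOneSpectrum (𝓞 K))) := by rw [← huniq]; exact_mod_cast h𝔭
    exact this
  subst h𝔭₀
  have hcard := natCard_residueField_adicCompletionIntegers_eq_of_absNorm 𝔭 hN
  obtain ⟨t, ht0, ht⟩ :=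
    exists_reductionAt_c₄_eq_pow_four_mul_intCast_of_semistabilityIndex_eq_four W p hp5 h4 he h𝔭
      hgood hpn hn
  have ht4 : (t ^ 4) ^ ((p - 1) / 4) = 1 := pow_pow_div_eq_one_of_natCard_eq p hcard h4 ht0
  have hj : ((W.baseChange K).reductionAt 𝔭).j = 1728 :=
    reductionAt_j_eq_of_valuation_lt_one (W.baseChange K) 𝔭 hgood
      (valuation_j_sub_lt_one_of_semistabilityIndex_eq_four W p hp5 he h𝔭 hgood)
  have hp1 : p % 4 = 1 := by have := hp.out.two_le; omega
  have key := SpecialJ.intCast_trace_eq_choose_mul_pow_of_j_eq ((W.baseChange K).reductionAt 𝔭)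
    hp.out hp1 hcard hj
  have hpow : (-((W.baseChange K).reductionAt 𝔭).c₄ / 48) ^ ((p - 1) / 4) =
      (-(n : ResidueField (𝔭.adicCompletionIntegers K)) / 48) ^ ((p - 1) / 4) := by
    rw [ht, show -(t ^ 4 * (n : ResidueField (𝔭.adicCompletionIntegers K))) / 48 =
      t ^ 4 * (-(n : ResidueField (𝔭.adicCompletionIntegers K)) / 48) by ring, mul_pow, ht4, one_mul]
  rw [hpow] at key
  haveI := Fintype.ofFinite (ResidueField (𝔭.adicCompletionIntegers K))
  obtain ⟨hchar, -⟩ := SpecialJ.ringChar_eq_of_natCard_eq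
    (k := ResidueField (𝔭.adicCompletionIntegers K)) hp.out hcard
  haveI : CharP (ResidueField (𝔭.adicCompletionIntegers K)) p := hchar ▸ ringChar.charP _
  exact ⟨key, (dvd_iff_of_intCast_trace_eq p key).trans (natCast_mul_pow_eq_one_iff_zmod p _ _ _ _)⟩

/-- **`ReductionNonAnomalous W p` on the defect-`4` cell is ONE residue of Cremona's `c₄`.** On the
type-(G) locus with `e_E(p) = 4` (`p ≥ 5`; then `4 ∣ p − 1`) and `c₄(E) = n·(−p)^v`, `p ∤ n`:
**`Delbourgo2002.ReductionNonAnomalous W p ⟺ ¬(C((p−1)/2,(p−1)/4)·(−n/48)^{(p−1)/4} = 1 in ZMod p)`**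
— every (G)-field place lifts to `ℚ(ζ_p)` with the same point count
(`exists_heightOneSpectrum_cyclotomic_over`). With gen 11/19 (never anomalous at `p ≥ 7`) the proviso
of Delbourgo's Theorem (B) on defect `4` is decided by `p` and this residue.
[cite: Delbourgo2002, p. 39 (definition of ℓ_p(E))] -/
theorem reductionNonAnomalous_iff_of_semistabilityIndex_eq_four (hp5 : 5 ≤ p) (hG : TypeG W p)
    (he : semistabilityIndex W p = 4) {n : ℤ} {v : ℕ} (hpn : ¬ (p : ℤ) ∣ n)
    (hn : W.c₄ = n * (-(p : ℚ)) ^ v) :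
    Delbourgo2002.ReductionNonAnomalous W p ↔
      ¬ ((((p - 1) / 2).choose ((p - 1) / 4) : ℕ) : ZMod p) * (-(n : ZMod p) / 48) ^ ((p - 1) / 4) = 1 := by
  have h4 := four_dvd_sub_one_of_typeG_of_semistabilityIndex_eq_four W p hp5 hG he
  constructor
  · intro hR hcong
    obtain ⟨L, _, _, _, F, hF⟩ := hG
    haveI : NumberField F := NumberField.of_module_finite ℚ F
    obtain ⟨w, hw⟩ := exists_heightOneSpectrum_natCast_mem F p
    have hgood := hF w hw
    obtain ⟨𝔓, h𝔓, hgoodL, hcount⟩ := exists_heightOneSpectrum_cyclotomic_over p W F w hw hgood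
    have hdvd := (intCast_trace_reductionAt_eq_and_dvd_iff_of_semistabilityIndex_eq_four W p hp5 h4 he
      h𝔓 hgoodL hpn hn).2.mpr hcong
    rw [hcount] at hdvd
    exact hR L F w hw hgood hdvd
  · intro hcong L _ _ _ F w hw hgood hdvd
    obtain ⟨𝔓, h𝔓, hgoodL, hcount⟩ := exists_heightOneSpectrum_cyclotomic_over p W F w hw hgood
    rw [← hcount] at hdvd
    exact hcong ((intCast_trace_reductionAt_eq_and_dvd_iff_of_semistabilityIndex_eq_four W p hp5 h4 he
      h𝔓 hgoodL hpn hn).2.mp hdvd)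

/-! ### `p = 5` -/

/-- **LAW 6 at `p = 5`: anomalous iff `c₄/(−5)^{v} ≡ 1 (mod 5)`.** `W` globally minimal with
`e_E(5) = 4`, `K` a `5`-th cyclotomic field, `𝔭 ∋ 5` good for `E_K`, `c₄(E) = n·(−5)^v`, `5 ∤ n`:
**`5 ∣ #Ẽ_𝔭(𝔽_5) ⟺ n ≡ 1 (mod 5)`** (`c₄(Ẽ) = t⁴·n̄ = n̄` in `𝔽_5` and gen 35's
`#Ẽ(𝔽_5) = 10 ⟺ c₄(Ẽ) = 1`; census: the 70 anomalous defect-`4` rows at `5` are exactly the rows with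
`n ≡ 1 (mod 5)`). [cite: IrelandRosen1990, Ch. 18 §4, Theorem 5] -/
theorem five_dvd_natCard_point_reductionAt_iff_intCast_modEq_one [h5 : Fact (Nat.Prime 5)]
    (he : semistabilityIndex W 5 = 4) {K : Type} [Field K] [NumberField K]
    [IsCyclotomicExtension {5} ℚ K] {𝔭 : HeightOneSpectrum (𝓞 K)}
    (h𝔭 : ((5 : ℕ) : 𝓞 K) ∈ 𝔭.asIdeal) (hgood : (W.baseChange K).HasGoodReductionAt 𝔭) {n : ℤ}
    {v : ℕ} (hpn : ¬ (5 : ℤ) ∣ n) (hn : W.c₄ = n * (-(5 : ℚ)) ^ v) :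
    5 ∣ Nat.card ((W.baseChange K).reductionAt 𝔭).toAffine.Point ↔ n ≡ 1 [ZMOD 5] := by
  haveI : (W.baseChange K).IsElliptic := by rw [baseChange]; infer_instance
  haveI : ((W.baseChange K).reductionAt 𝔭).IsElliptic := isElliptic_reductionAt hgood
  obtain ⟨𝔭₀, -, huniq, hN⟩ := exists_prime_over_prime 5 K
  have h𝔭₀ : 𝔭 = 𝔭₀ := by
    have : 𝔭 ∈ ({𝔭₀} : Set (HeightOneSpectrum (𝓞 K))) := by rw [← huniq]; exact_mod_cast h𝔭
    exact this
  subst h𝔭₀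
  have hcard := natCard_residueField_adicCompletionIntegers_eq_of_absNorm 𝔭 hN
  obtain ⟨t, ht0, ht⟩ :=
    exists_reductionAt_c₄_eq_pow_four_mul_intCast_of_semistabilityIndex_eq_four W 5 le_rfl
      (by norm_num) he h𝔭 hgood (by exact_mod_cast hpn) hn
  have ht4 : t ^ 4 = 1 := by
    have h := pow_pow_div_eq_one_of_natCard_eq 5 hcard (e := 4) (by norm_num) ht0
    rwa [show (5 - 1) / 4 = 1 from rfl, pow_one] at h
  rw [ht4, one_mul] at ht
  have hj : ((W.baseChange K).reductionAt 𝔭).j = 1728 :=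
    reductionAt_j_eq_of_valuation_lt_one (W.baseChange K) 𝔭 hgood
      (valuation_j_sub_lt_one_of_semistabilityIndex_eq_four W 5 le_rfl he h𝔭 hgood)
  rw [SpecialJ.five_dvd_natCard_point_iff_of_j_eq _ hcard hj,
    SpecialJ.natCard_point_eq_ten_iff_c₄_eq_one_of_j_eq _ hcard hj, ht]
  haveI := Fintype.ofFinite (ResidueField (𝔭.adicCompletionIntegers K))
  obtain ⟨hchar, -⟩ := SpecialJ.ringChar_eq_of_natCard_eq
    (k := ResidueField (𝔭.adicCompletionIntegers K)) h5.out hcard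
  haveI : CharP (ResidueField (𝔭.adicCompletionIntegers K)) 5 := hchar ▸ ringChar.charP _
  rw [← Int.cast_one, CharP.intCast_eq_intCast (ResidueField (𝔭.adicCompletionIntegers K)) 5]
  simp only [Nat.cast_ofNat]

/-- **`ReductionNonAnomalous W 5` on the defect-`4` cell: `⟺ c₄/(−5)^{v} ≢ 1 (mod 5)`.** On the
type-(G) locus at `p = 5` with `e_E(5) = 4` and `c₄(E) = n·(−5)^v`, `5 ∤ n`:
**`Delbourgo2002.ReductionNonAnomalous W 5 ⟺ ¬ n ≡ 1 (mod 5)`** (census: 163/233 defect-`4` rows at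
`5` non-anomalous, the other 70 carry the flag `Del02-ThmB-ellp-anomalous`).
[cite: Delbourgo2002, p. 39 (definition of ℓ_p(E))] -/
theorem reductionNonAnomalous_five_iff_of_semistabilityIndex_eq_four [h5 : Fact (Nat.Prime 5)]
    (hG : TypeG W 5) (he : semistabilityIndex W 5 = 4) {n : ℤ} {v : ℕ} (hpn : ¬ (5 : ℤ) ∣ n)
    (hn : W.c₄ = n * (-(5 : ℚ)) ^ v) :
    Delbourgo2002.ReductionNonAnomalous W 5 ↔ ¬ n ≡ 1 [ZMOD 5] := by
  constructor
  · intro hR hmod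
    obtain ⟨L, _, _, _, F, hF⟩ := hG
    haveI : NumberField F := NumberField.of_module_finite ℚ F
    obtain ⟨w, hw⟩ := exists_heightOneSpectrum_natCast_mem F 5
    have hgood := hF w hw
    obtain ⟨𝔓, h𝔓, hgoodL, hcount⟩ := exists_heightOneSpectrum_cyclotomic_over 5 W F w hw hgood
    have hdvd := (five_dvd_natCard_point_reductionAt_iff_intCast_modEq_one W he h𝔓 hgoodL hpn hn).mpr
      hmod
    rw [hcount] at hdvd
    exact hR L F w hw hgood hdvd
  · intro hmod L _ _ _ F w hw hgood hdvd
    obtain ⟨𝔓, h𝔓, hgoodL, hcount⟩ := exists_heightOneSpectrum_cyclotomic_over 5 W F w hw hgood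
    rw [← hcount] at hdvd
    exact hmod ((five_dvd_natCard_point_reductionAt_iff_intCast_modEq_one W he h𝔓 hgoodL hpn hn).mp hdvd)

end Four

end Summit.BirchSwinnertonDyer.Rank1Residual.Additive

end
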